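import Literature.Analysis.Matrix.QuadraticCombesThomas

/-!
# `T4Continuum.ShellMeasurePenalisedCoercivity` — ROW S120 = J5 of the NE7c (α)-JUNCTION PROGRAMME: PENALISED COERCIVITY —
# a gap on the constraint slice + a penalty bounded below off the slice ⟹ accretivity of `A + a·CᴴC` on the WHOLE space
# (the `hacc` shape of `Literature.Analysis.Matrix.CoerciveCombesThomas.accretive_combes_thomas` and of the `Beta/` engines)

(cell `pub-balaban`, sub-cell `t4`, NE7c (node U5b); estimate lane; owner RULING R-ne7cp1-g37-9 (journal l.24086) books the lemma:
«the J-programme's suppliers give the GAP either ON THE SLICE (NE3's `SlicePoincare`: `T = {QY = 0, RD^*Y = 0}`) or as a cell-sum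
coercivity (`Beta/MultiscaleCoercive*`), while the CT consumers want `hacc : ∀ v, m·Σ‖v i‖² ≤ Re Σ conj(v i)·(A v) i` on the WHOLE
space for `A = Δ₁ + D^*RD + aQ^*Q` ([Balaban1985Variational] (81)∕(101)–(103); [B9] Sect. A–B's `Δ_a = Δ + DRD^* + Q^*aQ`) —
the bridge is ABSTRACT LINEAR ALGEBRA»; imports `Literature/Analysis/Matrix/QuadraticCombesThomas` ONLY (for the tree's Cauchy–Schwarz `norm_star_dotProduct_le_sqrt_mul_sqrt`); touches NO host, NO row of the ONE CALL; census COUNT unchanged;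
[folklore]; 0 `def`, 0 `def … : Prop`, 0 sorry, 0 citation tags.)

HONEST FRAMING.  Finite four-torus programme, rung (B)+1 only — NOT infinite volume, NOT a mass gap, NOT the Clay problem, NOT
summit progress.  NE7c (`T4IndicatorShell.ShellWeightBound`) is NOT PRINTED in [Balaban 1983–89] and NOT PROVED; «NE7c ⇐ the named
binders» (trigger c3).  THIS FILE is a generic finite-dimensional lemma of OURS; the slice gap, the penalty's lower bound and the
sesquilinear bound are HYPOTHESES (their suppliers are NE3's slice coercivity ∕ `Beta/MultiscaleCoercive*` ∕ node O); nothing of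
Bałaban's is asserted, cited or discharged.  HONEST DEPENDENCY (cell): continuum YM on T⁴ ⇐ BetaPertH ∧ nine spine estimates
(0/9 proved); BetaPertH ⇐ (D1) ∧ (D4) ∧ CAP+tail; G-an2-4 gates asym, D1 and NE2/3/4.

THE STATEMENT.  `ι, κ` finite; `A : Matrix ι ι ℂ`, `C : Matrix κ ι ℂ` (the STACKED penalty, e.g. `C = (R^{1∕2}D^* ; a′^{1∕2}Q)`);
a splitting of every vector `v = πT v + πS v` supplied as DATA (two maps, no linearity required) with `C (πT v) = 0` (the slice is
in the kernel of the penalty) and `σ²·Σ‖πS v‖² ≤ Σ‖(C (πS v)) k‖²` (the penalty is bounded below OFF the slice); the slice gap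
`m·Σ‖πT v‖² ≤ Re⟨πT v, A (πT v)⟩`; the sesquilinear bound `‖⟨t, A s⟩‖ ≤ Λ‖t‖‖s‖` for all `t, s`.  THEN for every
`a ≥ a₀ := (Λ + 2Λ²∕m + m∕2)∕σ²`:
* `penalised_coercive_split` — `(m∕2)·(Σ‖πT v‖² + Σ‖πS v‖²) ≤ Re⟨v, (A + a·CᴴC) v⟩` (the 2×2 step
  `mT² − 2ΛTS − ΛS² + aσ²S² ≥ (m∕2)(T² + S²)`, i.e. `(m∕2)(T − (2Λ∕m)S)² ≥ 0`);
* `penalised_accretive` — `(m∕4)·Σ‖v i‖² ≤ Re Σ conj(v i)·((A + a·CᴴC) v) i` — the `hacc` shape (`‖t + s‖² ≤ 2‖t‖² + 2‖s‖²`).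
-/

noncomputable section

open Finset
open scoped Matrix ComplexConjugate

namespace Summit.QuantumFields.BalabanUV.T4Continuum.ShellMeasurePenalisedCoercivity

open Literature.Analysis.Matrix (norm_star_dotProduct_le_sqrt_mul_sqrt)

variable {ι κ : Type*} [Fintype ι] [Fintype κ]

/-! ## §1 ℓ² bookkeeping on `ι → ℂ` -/

/-- `⟨x, x⟩ = Σ‖x k‖²` as a complex number. [folklore] -/
theorem star_dotProduct_self_eq (x : κ → ℂ) : star x ⬝ᵥ x = ((∑ k, ‖x k‖ ^ 2 : ℝ) : ℂ) := by
  simp only [dotProduct, Pi.star_apply, Complex.star_def, Complex.conj_mul', Complex.ofReal_sum, Complex.ofReal_pow]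

/-- `Σ‖t i + s i‖² ≤ 2Σ‖t i‖² + 2Σ‖s i‖²`. [folklore] -/
theorem sum_norm_sq_add_le (t s : ι → ℂ) :
    ∑ i, ‖(t + s) i‖ ^ 2 ≤ 2 * ∑ i, ‖t i‖ ^ 2 + 2 * ∑ i, ‖s i‖ ^ 2 := by
  rw [Finset.mul_sum, Finset.mul_sum, ← Finset.sum_add_distrib]
  refine Finset.sum_le_sum fun i _ => ?_
  have h := norm_add_le (t i) (s i)
  have h0 := norm_nonneg (t i + s i)
  rw [Pi.add_apply]
  nlinarith [sq_nonneg (‖t i‖ - ‖s i‖), norm_nonneg (t i), norm_nonneg (s i)]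

/-- The penalty's quadratic form is the squared norm of `C v`: `⟨v, CᴴC v⟩ = Σ‖(Cv) k‖²`. [folklore] -/
theorem star_dotProduct_conjTranspose_mul_mulVec (C : Matrix κ ι ℂ) (v : ι → ℂ) :
    star v ⬝ᵥ ((Cᴴ * C) *ᵥ v) = ((∑ k, ‖(C *ᵥ v) k‖ ^ 2 : ℝ) : ℂ) := by
  rw [← Matrix.mulVec_mulVec, Matrix.dotProduct_mulVec, ← Matrix.star_mulVec, star_dotProduct_self_eq]

/-! ## §2 Penalised coercivity -/

/-- **PENALISED COERCIVITY, SPLIT FORM.**  `A : Matrix ι ι ℂ`, `C : Matrix κ ι ℂ`; a splitting `v = πT v + πS v` (DATA) with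
`C (πT v) = 0` and `σ²Σ‖πS v‖² ≤ Σ‖C (πS v)‖²` (`σ > 0`); the slice gap `mΣ‖πT v‖² ≤ Re⟨πT v, A(πT v)⟩` (`m > 0`); the sesquilinear
bound `‖⟨t, As⟩‖ ≤ Λ√(Σ‖t‖²)√(Σ‖s‖²)` (`Λ ≥ 0`).  Then for `a ≥ (Λ + 2Λ²∕m + m∕2)∕σ²`:
`(m∕2)(Σ‖πT v‖² + Σ‖πS v‖²) ≤ Re⟨v, (A + a·CᴴC)v⟩`. [folklore] -/
theorem penalised_coercive_split (A : Matrix ι ι ℂ) (C : Matrix κ ι ℂ) (πT πS : (ι → ℂ) → (ι → ℂ))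
    (hsplit : ∀ v, πT v + πS v = v) (hker : ∀ v, C *ᵥ πT v = 0)
    {Λ σ m : ℝ} (hΛ : 0 ≤ Λ) (hσ : 0 < σ) (hm : 0 < m)
    (hbd : ∀ t s : ι → ℂ, ‖star t ⬝ᵥ (A *ᵥ s)‖ ≤ Λ * Real.sqrt (∑ i, ‖t i‖ ^ 2) * Real.sqrt (∑ i, ‖s i‖ ^ 2))
    (hlow : ∀ v, σ ^ 2 * ∑ i, ‖πS v i‖ ^ 2 ≤ ∑ k, ‖(C *ᵥ πS v) k‖ ^ 2)
    (hgap : ∀ v, m * ∑ i, ‖πT v i‖ ^ 2 ≤ (star (πT v) ⬝ᵥ (A *ᵥ πT v)).re)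
    {a : ℝ} (ha : (Λ + 2 * Λ ^ 2 / m + m / 2) / σ ^ 2 ≤ a) (v : ι → ℂ) :
    m / 2 * (∑ i, ‖πT v i‖ ^ 2 + ∑ i, ‖πS v i‖ ^ 2) ≤
      (star v ⬝ᵥ ((A + (a : ℂ) • (Cᴴ * C)) *ᵥ v)).re := by
  set t := πT v with ht
  set s := πS v with hs
  set T := Real.sqrt (∑ i, ‖t i‖ ^ 2) with hT
  set S := Real.sqrt (∑ i, ‖s i‖ ^ 2) with hS
  have hT0 : 0 ≤ ∑ i, ‖t i‖ ^ 2 := Finset.sum_nonneg fun i _ => by positivity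
  have hS0 : 0 ≤ ∑ i, ‖s i‖ ^ 2 := Finset.sum_nonneg fun i _ => by positivity
  have hTT : T ^ 2 = ∑ i, ‖t i‖ ^ 2 := Real.sq_sqrt hT0
  have hSS : S ^ 2 = ∑ i, ‖s i‖ ^ 2 := Real.sq_sqrt hS0
  have hTn : 0 ≤ T := Real.sqrt_nonneg _
  have hSn : 0 ≤ S := Real.sqrt_nonneg _
  have hv : v = t + s := (hsplit v).symm
  -- (1) the `A`-form expanded along `v = t + s`
  have hA : star v ⬝ᵥ (A *ᵥ v) =
      star t ⬝ᵥ (A *ᵥ t) + star t ⬝ᵥ (A *ᵥ s) + (star s ⬝ᵥ (A *ᵥ t) + star s ⬝ᵥ (A *ᵥ s)) := by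
    rw [hv, Matrix.mulVec_add, star_add, add_dotProduct, dotProduct_add, dotProduct_add]
  -- (2) the penalty form: `C v = C s`
  have hkt : C *ᵥ t = 0 := hker v
  have hCv : C *ᵥ v = C *ᵥ s := by rw [hv, Matrix.mulVec_add, hkt, zero_add]
  have hP : star v ⬝ᵥ (((a : ℂ) • (Cᴴ * C)) *ᵥ v) = ((a * ∑ k, ‖(C *ᵥ s) k‖ ^ 2 : ℝ) : ℂ) := by
    rw [Matrix.smul_mulVec, dotProduct_smul, star_dotProduct_conjTranspose_mul_mulVec, hCv, smul_eq_mul,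
      Complex.ofReal_mul]
  -- (3) the real parts
  have hre : (star v ⬝ᵥ ((A + (a : ℂ) • (Cᴴ * C)) *ᵥ v)).re =
      (star t ⬝ᵥ (A *ᵥ t)).re + (star t ⬝ᵥ (A *ᵥ s)).re + (star s ⬝ᵥ (A *ᵥ t)).re + (star s ⬝ᵥ (A *ᵥ s)).re +
        a * ∑ k, ‖(C *ᵥ s) k‖ ^ 2 := by
    rw [Matrix.add_mulVec, dotProduct_add, Complex.add_re, hA, hP, Complex.ofReal_re]
    simp only [Complex.add_re]
    ring
  have h1 : m * T ^ 2 ≤ (star t ⬝ᵥ (A *ᵥ t)).re := by rw [hTT]; exact hgap v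
  have h2 : -(Λ * T * S) ≤ (star t ⬝ᵥ (A *ᵥ s)).re :=
    (neg_le_neg (hbd t s)).trans (abs_le.mp (Complex.abs_re_le_norm _)).1
  have h3 : -(Λ * S * T) ≤ (star s ⬝ᵥ (A *ᵥ t)).re :=
    (neg_le_neg (hbd s t)).trans (abs_le.mp (Complex.abs_re_le_norm _)).1
  have h4 : -(Λ * S * S) ≤ (star s ⬝ᵥ (A *ᵥ s)).re :=
    (neg_le_neg (hbd s s)).trans (abs_le.mp (Complex.abs_re_le_norm _)).1
  have h5 : a * (σ ^ 2 * S ^ 2) ≤ a * ∑ k, ‖(C *ᵥ s) k‖ ^ 2 := by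
    have ha0 : 0 ≤ a := le_trans (by positivity) ha
    rw [hSS]
    exact mul_le_mul_of_nonneg_left (hlow v) ha0
  -- (4) the 2×2 step: `aσ² ≥ Λ + 2Λ²/m + m/2`
  have hσ2 : 0 < σ ^ 2 := by positivity
  have ha' : Λ + 2 * Λ ^ 2 / m + m / 2 ≤ a * σ ^ 2 := by
    rwa [div_le_iff₀ hσ2] at ha
  have hkey : m / 2 * (T ^ 2 + S ^ 2) ≤
      m * T ^ 2 - Λ * T * S - Λ * S * T - Λ * S * S + a * (σ ^ 2 * S ^ 2) := by
    have hsq : 0 ≤ m / 2 * (T - 2 * Λ / m * S) ^ 2 := by positivity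
    have hexp : m / 2 * (T - 2 * Λ / m * S) ^ 2 = m / 2 * T ^ 2 - 2 * Λ * T * S + 2 * Λ ^ 2 / m * S ^ 2 := by
      field_simp
      ring
    nlinarith [mul_le_mul_of_nonneg_right ha' (sq_nonneg S)]
  rw [hre, hTT.symm, hSS.symm]
  linarith

/-- **PENALISED ACCRETIVITY — the `hacc` shape.**  Under the hypotheses of `penalised_coercive_split`, for `a ≥ (Λ + 2Λ²∕m + m∕2)∕σ²`:
`(m∕4)·Σ‖v i‖² ≤ Re Σ conj(v i)·((A + a·CᴴC)v) i` — literally the accretivity hypothesis of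
`Literature.Analysis.Matrix.accretive_combes_thomas` (and, with `nsq`, of the `Beta/AccretiveCombesThomas` engine) for the penalised
operator, with `m∕4` in place of the slice gap `m`. [folklore] -/
theorem penalised_accretive (A : Matrix ι ι ℂ) (C : Matrix κ ι ℂ) (πT πS : (ι → ℂ) → (ι → ℂ))
    (hsplit : ∀ v, πT v + πS v = v) (hker : ∀ v, C *ᵥ πT v = 0)
    {Λ σ m : ℝ} (hΛ : 0 ≤ Λ) (hσ : 0 < σ) (hm : 0 < m)
    (hbd : ∀ t s : ι → ℂ, ‖star t ⬝ᵥ (A *ᵥ s)‖ ≤ Λ * Real.sqrt (∑ i, ‖t i‖ ^ 2) * Real.sqrt (∑ i, ‖s i‖ ^ 2))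
    (hlow : ∀ v, σ ^ 2 * ∑ i, ‖πS v i‖ ^ 2 ≤ ∑ k, ‖(C *ᵥ πS v) k‖ ^ 2)
    (hgap : ∀ v, m * ∑ i, ‖πT v i‖ ^ 2 ≤ (star (πT v) ⬝ᵥ (A *ᵥ πT v)).re)
    {a : ℝ} (ha : (Λ + 2 * Λ ^ 2 / m + m / 2) / σ ^ 2 ≤ a) :
    ∀ v : ι → ℂ, m / 4 * ∑ i, ‖v i‖ ^ 2 ≤ (∑ i, star (v i) * ((A + (a : ℂ) • (Cᴴ * C)) *ᵥ v) i).re := by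
  intro v
  have h := penalised_coercive_split A C πT πS hsplit hker hΛ hσ hm hbd hlow hgap ha v
  have hv : ∑ i, ‖v i‖ ^ 2 ≤ 2 * ∑ i, ‖πT v i‖ ^ 2 + 2 * ∑ i, ‖πS v i‖ ^ 2 := by
    have := sum_norm_sq_add_le (πT v) (πS v)
    rwa [hsplit v] at this
  have hdot : (∑ i, star (v i) * ((A + (a : ℂ) • (Cᴴ * C)) *ᵥ v) i) =
      star v ⬝ᵥ ((A + (a : ℂ) • (Cᴴ * C)) *ᵥ v) := rfl
  rw [hdot]
  nlinarith

/-! ## §3 Non-vacuity (crew rule G-1): the hypotheses are jointly inhabited -/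

/-- On `Fin 2` with `A = m·1`, `C = σ·1` and the trivial slice `πT = 0`, `πS = id`, every hypothesis holds (`Λ = m`,
`a = a₀`), so the binder list is jointly inhabited (crew rule G-1); an instance with a genuine slice is the consumer's (J3 ∕ node O).
[folklore] -/
example (m σ : ℝ) (hm : 0 < m) (hσ : 0 < σ) (v : Fin 2 → ℂ) :
    m / 4 * ∑ i, ‖v i‖ ^ 2 ≤
      (∑ i, star (v i) * ((((m : ℂ)) • (1 : Matrix (Fin 2) (Fin 2) ℂ) +
        (((m + 2 * m ^ 2 / m + m / 2) / σ ^ 2 : ℝ) : ℂ) • (((σ : ℂ) • (1 : Matrix (Fin 2) (Fin 2) ℂ))ᴴ *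
          ((σ : ℂ) • (1 : Matrix (Fin 2) (Fin 2) ℂ)))) *ᵥ v) i).re := by
  refine penalised_accretive ((m : ℂ) • (1 : Matrix (Fin 2) (Fin 2) ℂ)) ((σ : ℂ) • (1 : Matrix (Fin 2) (Fin 2) ℂ))
    (fun _ => 0) (fun v => v) (fun v => by simp) (fun v => by simp) hm.le hσ hm ?_ ?_ ?_ le_rfl v
  · intro t s
    rw [Matrix.smul_mulVec, Matrix.one_mulVec, dotProduct_smul, smul_eq_mul, norm_mul, Complex.norm_real,
      Real.norm_eq_abs, abs_of_pos hm, mul_assoc]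
    exact mul_le_mul_of_nonneg_left (norm_star_dotProduct_le_sqrt_mul_sqrt t s) hm.le
  · intro v
    apply le_of_eq
    rw [Matrix.smul_mulVec, Matrix.one_mulVec, Finset.mul_sum]
    refine Finset.sum_congr rfl fun k _ => ?_
    rw [Pi.smul_apply, smul_eq_mul, norm_mul, Complex.norm_real, Real.norm_eq_abs, abs_of_pos hσ, mul_pow]
  · intro v
    simp

end Summit.QuantumFields.BalabanUV.T4Continuum.ShellMeasurePenalisedCoercivity

end
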